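import Literature.Computability.AlgebraicComplexity.AlmanLi2026IteratedFreeLunch
import Literature.Computability.AlgebraicComplexity.AlmanLi2026AppendDirectSumBound
import HarnessLib

/-!
# Alman–Li 2026, Thm. 6.2 (iterated one-slice speedup) for border-rank data

Topic `Literature/Computability/AlgebraicComplexity` (family `MatrixMultiplication`). Source: J. Alman,
B. Li, *Asymptotic Rank Speedup Theorems, Revisited*, arXiv:2605.21738 (2026), Thm. 6.2 (held text
`paper:arxiv-2605.21738`, p0015 L57–62): "Under the setting of Theorem 6.1, let `t = r+s−2n`. There
exists a degeneration
`T^{⊗2} ⊕ 2⊙T⊗⟨1,t,1⟩ ⊕ ⟨1, t²+2n², 1⟩ ⊴ ⟨r²⟩ ⊕ 2r⊙⟨1,s,1⟩ ⊕ ⟨1,s²,1⟩`."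
The setting of Thm. 6.1 (p0015 L5–13): `T ⊴ ⟨r⟩` presented by `𝔽(λ)`-vectors
`∑ᵢ aᵢbᵢcᵢ = T + O(λ)` and nonzero `c'ᵢ ∈ 𝔽(λ)` with `rank ∑ᵢ aᵢbᵢc'ᵢ ≤ s`.

The tree's `AlmanLi2026.thm62_rankDecomposition` is the `λ`-free case (a rank decomposition over the
ground field).  This file proves the printed border-rank form by the route of Cor. 5.1 exactly as the
tree does for `cw_q` in `AlmanLi2026IteratedCWPower`: apply the `λ`-free theorem over the FIELD
`L = K(λ)` to `T_λ` (the image of the `K[λ]`-tensor `P = λ^h T + O(λ^{h+1})`), rescale the third mode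
blockwise by `1, λ^h, λ^h` on the corner-deleted square and by `λ^{2h}` on the appended slice (an
`L`-restriction), read the result as the image of a `K[λ]`-family with lowest term the printed target
at order `2h`, and bootstrap to `K` (`AlmanLi2026.algDegeneratesTo_of_isFractionRing`).

* `AlmanLi2026.thm62_degeneration_of_decomposition` — for `T : ι' → κ' → μ' → K` (`|ι'| = n`,
  `|κ'| = m`), border-rank data `(P, u, v, w)` over `K(λ)` indexed by a finite type `σ` (`r = |σ|`),
  nonzero `c'` with `rank ≤ s`, and any `t ≤ r + s − (n+m)`:
  `(⟨r⟩ ⊕ ⟨s-slice⟩)^{⊠2} ⊵ (T ⊕ ⟨t-slice⟩)^{⊠2}∖(⟨t-slice⟩^{⊠2}) ⊕ ⟨((r+s)² − ((n²+2nt) + (m²+2mt)))-slice⟩`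
  (for `n = m`, `t = r+s−2n` the appended slice has size `t² + 2n²`; slices with trivial factor third;
  the corner-deleted square `squareMinusCorner` is `T^{⊠2} ⊕ 2⊙T⊗⟨1,t,1⟩` up to relabelling, tree
  `AlmanLi2026.squareMinusCorner_eq_directSum`).

No definitions, no named facts.

## References

* J. Alman, B. Li, *Asymptotic Rank Speedup Theorems, Revisited*, arXiv:2605.21738 (2026), Thm. 6.2,
  Thm. 6.1, Cor. 5.1 (proof). [AlmanLi2026]
-/

noncomputable section

open scoped BigOperators Polynomial
open Polynomial

namespace Literature.Computability.AlgebraicComplexity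

namespace AlmanLi2026

variable (K : Type) [Field K]

/-- Images of `0/1` tensors under `φ ∘ C`: the Kronecker square of `⟨r⟩ ⊕ ⟨s-slice⟩` over `L` is the
image of the one over `K`. [cite: AlmanLi2026, Cor. 5.1 (proof)] -/
private theorem kronecker_unit_slice_eq_map₈ {L : Type} [CommRing L] [Algebra K[X] L] (r s : ℕ) :
    kroneckerTensor (directSumTensor (unitTensor L r) (rotate (oneSliceTensor L (Fin s))))
        (directSumTensor (unitTensor L r) (rotate (oneSliceTensor L (Fin s)))) =
      fun a b c => algebraMap K[X] L (Polynomial.C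
        (kroneckerTensor (directSumTensor (unitTensor K r) (rotate (oneSliceTensor K (Fin s))))
          (directSumTensor (unitTensor K r) (rotate (oneSliceTensor K (Fin s)))) a b c)) := by
  funext a b c
  rw [kroneckerTensor_apply, kroneckerTensor_apply, map_mul, map_mul]
  congr 1 <;>
  · rcases a with ⟨a | a, a' | a'⟩ <;> rcases b with ⟨b | b, b' | b'⟩ <;> rcases c with ⟨c | c, c' | c'⟩ <;>
      simp [directSumTensor, unitTensor_apply, rotate_apply, oneSliceTensor_apply,
        apply_ite Polynomial.C, apply_ite (algebraMap K[X] L)]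

/-- Coefficients of `ε^h · C v`: the profile "order `h`, leading coefficient `v`".
[cite: AlmanLi2026, Cor. 5.1 (proof)] -/
private theorem coeff_X_pow_mul_C_ite₈ (h : ℕ) (v : K) :
    ∀ j ≤ h, (X ^ h * Polynomial.C v : K[X]).coeff j = if j = h then v else 0 := by
  intro j _
  rw [Polynomial.coeff_X_pow_mul', Polynomial.coeff_C]
  by_cases hj : j = h
  · subst hj; simp
  · rw [if_neg hj]
    split_ifs with h1 h2
    · omega
    · rfl
    · rfl

set_option maxHeartbeats 1000000 in -- 64-way block case analysis in `hscale`
/-- **Alman–Li 2026, Thm. 6.2 for border-rank data (as printed, "under the setting of Thm. 6.1").**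
Let `T : ι' → κ' → μ' → K` (`n = |ι'|`, `m = |κ'|`) have border-rank data over `L = K(λ)`: a
`K[λ]`-tensor `P = λ^h T + O(λ^{h+1})` whose image over `L` is `∑_{i ∈ σ} uᵢ ⊗ vᵢ ⊗ wᵢ` (`r = |σ|`),
and nonzero `c'ᵢ ∈ L` with `rank ∑ᵢ c'ᵢ uᵢvᵢᵀ ≤ s`.  Then for every `t ≤ r + s − (n+m)`:
`(⟨r⟩ ⊕ ⟨s-slice⟩)^{⊠2} ⊵ (T ⊕ ⟨t-slice⟩)^{⊠2}∖(⟨t-slice⟩^{⊠2}) ⊕ ⟨((r+s)² − ((n²+2nt)+(m²+2mt)))-slice⟩`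
over `K` — printed: `T^{⊗2} ⊕ 2⊙T⊗⟨1,t,1⟩ ⊕ ⟨1,t²+2n²,1⟩ ⊴ ⟨r²⟩ ⊕ 2r⊙⟨1,s,1⟩ ⊕ ⟨1,s²,1⟩`
(`n = m`, `t = r+s−2n`).  Proof: `thm62_rankDecomposition` over the field `L`, blockwise rescaling
of the third mode, bootstrapping (Cor. 5.1). [cite: AlmanLi2026, Thm. 6.2] -/
theorem thm62_degeneration_of_decomposition {ι' κ' μ' σ : Type} [Fintype ι'] [Fintype κ']
    [Fintype μ'] [DecidableEq ι'] [DecidableEq κ'] [DecidableEq μ'] [Fintype σ]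
    {T : ι' → κ' → μ' → K} {P : ι' → κ' → μ' → K[X]} {h : ℕ}
    (hP : ∀ a b c, ∀ j ≤ h, (P a b c).coeff j = if j = h then T a b c else 0)
    {u : σ → ι' → RatFunc K} {v : σ → κ' → RatFunc K} {w : σ → μ' → RatFunc K}
    (hdec : ∀ a b c, algebraMap K[X] (RatFunc K) (P a b c) = ∑ i, u i a * v i b * w i c)
    {c' : σ → RatFunc K} (hc' : ∀ i, c' i ≠ 0) {s : ℕ}
    (hM : (Matrix.of fun a b => ∑ i, u i a * v i b * c' i).rank ≤ s) {t : ℕ}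
    (ht : t ≤ Fintype.card σ + s - (Fintype.card ι' + Fintype.card κ')) :
    AlgDegeneratesTo
      (kroneckerTensor
        (directSumTensor (unitTensor K (Fintype.card σ)) (rotate (oneSliceTensor K (Fin s))))
        (directSumTensor (unitTensor K (Fintype.card σ)) (rotate (oneSliceTensor K (Fin s)))))
      (directSumTensor
        (squareMinusCorner T (rotate (oneSliceTensor K (Fin t))))
        (rotate (oneSliceTensor K (Fin ((Fintype.card σ + s) * (Fintype.card σ + s) -
          ((Fintype.card ι' * Fintype.card ι' + 2 * (Fintype.card ι' * t)) +
            (Fintype.card κ' * Fintype.card κ' + 2 * (Fintype.card κ' * t)))))))) := by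
  classical
  set φ : K[X] →+* RatFunc K := algebraMap K[X] (RatFunc K) with hφdef
  set r := Fintype.card σ with hr
  set t' := (r + s) * (r + s) - ((Fintype.card ι' * Fintype.card ι' + 2 * (Fintype.card ι' * t)) +
    (Fintype.card κ' * Fintype.card κ' + 2 * (Fintype.card κ' * t))) with ht'
  -- the `L`-tensor `T_L = φ ∘ P` and its decomposition reindexed by `Fin r`
  obtain ⟨TL, hTLdef⟩ : ∃ TL : ι' → κ' → μ' → RatFunc K, TL = fun a b c => φ (P a b c) := ⟨_, rfl⟩
  set e := Fintype.equivFin σ with he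
  have hTr : ∀ a b c, TL a b c = ∑ i : Fin r, u (e.symm i) a * v (e.symm i) b * w (e.symm i) c :=
    fun a b c => by
      rw [hTLdef]
      show φ (P a b c) = _
      rw [hdec, ← e.symm.sum_comp]
  have hMr : (Matrix.of fun a b => ∑ i : Fin r, u (e.symm i) a * v (e.symm i) b * c' (e.symm i)).rank
      ≤ s := by
    have heq : (Matrix.of fun a b => ∑ i : Fin r, u (e.symm i) a * v (e.symm i) b * c' (e.symm i)) =
        Matrix.of fun a b => ∑ i, u i a * v i b * c' i := by
      ext a b
      rw [Matrix.of_apply, Matrix.of_apply]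
      exact e.symm.sum_comp (fun i => u i a * v i b * c' i)
    rw [heq]
    exact hM
  -- Thm. 6.2 (rank decompositions) over the field `L`
  have hdegL := thm62_rankDecomposition (K := RatFunc K) (T := TL)
    (A := fun a i => u (e.symm i) a) (B := fun b i => v (e.symm i) b) (C₀ := fun c i => w (e.symm i) c)
    hTr (c' := fun i => c' (e.symm i)) (fun i => hc' _) hMr (t := t) ht
  -- the `K[λ]`-family `Q₁ = P ⊕ λ^h ⟨1,t,1⟩ = λ^h (T ⊕ ⟨1,t,1⟩) + O(λ^{h+1})`
  obtain ⟨Q₁, hQ₁def⟩ : ∃ Q₁ : ι' ⊕ Fin t → κ' ⊕ Fin t → μ' ⊕ Unit → K[X],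
      Q₁ = directSumTensor P
        (fun x y z => X ^ h * Polynomial.C (rotate (oneSliceTensor K (Fin t)) x y z)) := ⟨_, rfl⟩
  have hQ₁ : ∀ a b c, ∀ j ≤ h, (Q₁ a b c).coeff j = if j = h then
      directSumTensor T (rotate (oneSliceTensor K (Fin t))) a b c else 0 := by
    rw [hQ₁def]
    exact coeff_directSum_X_pow_mul P _ hP
  -- the full family: corner-deleted square of `Q₁`, plus `λ^{2h} ⟨1,t',1⟩`
  obtain ⟨Pf, hPfdef⟩ : ∃ Pf :
      ((ι' × ι') ⊕ ((ι' × Fin t) ⊕ (Fin t × ι'))) ⊕ Fin t' →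
      ((κ' × κ') ⊕ ((κ' × Fin t) ⊕ (Fin t × κ'))) ⊕ Fin t' →
      ((μ' × μ') ⊕ ((μ' × Unit) ⊕ (Unit × μ'))) ⊕ Unit → K[X],
      Pf = directSumTensor
        (fun x y z => Q₁ (cornerCompl _ _ x).1 (cornerCompl _ _ y).1 (cornerCompl _ _ z).1 *
          Q₁ (cornerCompl _ _ x).2 (cornerCompl _ _ y).2 (cornerCompl _ _ z).2)
        (fun x y z => X ^ (h + h) * Polynomial.C (rotate (oneSliceTensor K (Fin t')) x y z)) :=
    ⟨_, rfl⟩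
  have hPfcoeff : ∀ a b c, ∀ j ≤ h + h, (Pf a b c).coeff j = if j = h + h then
      directSumTensor (squareMinusCorner T (rotate (oneSliceTensor K (Fin t))))
        (rotate (oneSliceTensor K (Fin t'))) a b c
      else 0 := by
    intro a b c j hj
    rcases a with a | a <;> rcases b with b | b <;> rcases c with c | c
    · rw [hPfdef, directSumTensor_inl, directSumTensor_inl]
      exact coeff_mul_eq_ite_of_coeff_eq_ite (hQ₁ _ _ _) (hQ₁ _ _ _) j hj
    · simp [hPfdef, directSumTensor]
    · simp [hPfdef, directSumTensor]
    · simp [hPfdef, directSumTensor]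
    · simp [hPfdef, directSumTensor]
    · simp [hPfdef, directSumTensor]
    · simp [hPfdef, directSumTensor]
    · rw [hPfdef, directSumTensor_inr, directSumTensor_inr]
      exact coeff_X_pow_mul_C_ite₈ K (h + h) _ j hj
  -- equalise the `λ`-orders over `L`: scale the third mode blockwise (`1`, `λ^h`, `λ^h`; `λ^{2h}`)
  have hscale : TensorRestrictsTo
      (directSumTensor (squareMinusCorner TL (rotate (oneSliceTensor (RatFunc K) (Fin t))))
        (rotate (oneSliceTensor (RatFunc K) (Fin t'))))
      (fun a b c => φ (Pf a b c)) := by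
    refine ⟨fun a a' => if a' = a then 1 else 0, fun b b' => if b' = b then 1 else 0,
      fun c c' => if c' = c then
        Sum.elim (Sum.elim (fun _ => (1 : RatFunc K))
          (Sum.elim (fun _ => φ X ^ h) (fun _ => φ X ^ h)))
          (fun _ => φ X ^ (h + h)) c else 0,
      fun a b c => ?_⟩
    rw [Finset.sum_eq_single a (fun x _ hx => by simp [hx]) (by simp),
      Finset.sum_eq_single b (fun x _ hx => by simp [hx]) (by simp),
      Finset.sum_eq_single c (fun x _ hx => by simp [hx]) (by simp)]
    simp only [if_true, one_mul]
    rcases a with (a | a | a) | a <;> rcases b with (b | b | b) | b <;>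
      rcases c with (c | c | c) | c <;>
      (simp [hPfdef, hQ₁def, squareMinusCorner, cornerCompl, directSumTensor, kroneckerTensor_apply,
        hTLdef, rotate_apply, oneSliceTensor_apply, apply_ite Polynomial.C, apply_ite φ, pow_add];
        try simp only [mul_comm]; try ring)
  have hdegL' : AlgDegeneratesTo
      (fun a b c => φ (Polynomial.C
        (kroneckerTensor
          (directSumTensor (unitTensor K r) (rotate (oneSliceTensor K (Fin s))))
          (directSumTensor (unitTensor K r) (rotate (oneSliceTensor K (Fin s)))) a b c)))
      (fun a b c => φ (Pf a b c)) := by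
    rw [← kronecker_unit_slice_eq_map₈ K]
    exact hdegL.trans_restrictsTo hscale
  -- bootstrap `K(λ) → K`
  exact algDegeneratesTo_of_isFractionRing (K := K) (L := RatFunc K) hPfcoeff hdegL'

end AlmanLi2026

end Literature.Computability.AlgebraicComplexity

end
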